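import Literature.RingTheory.FormalGroups.BudCocycleCoeff
import Literature.RingTheory.FormalGroups.LazardComparisonLemmaNilpotent
import Literature.RingTheory.FormalGroups.FormalGroupHom
import HarnessLib

/-!
# Lazard's bud lemma: the obstruction to extending a strict isomorphism of buds is a symmetric 2-cocycle
# ([Lazard 1955] Lemme 2, Prop. 1–2 and §III (3.4)–(3.6))

Topic `Literature/RingTheory/FormalGroups`; namespace `Literature.RingTheory.FormalGroups`.  THEOREMS ONLY; no definition,
no named fact, no instance, no `sorry`.  Setting: commutative one-dimensional formal group laws `G`, `H` over `B` (Mathlib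
`FormalGroup`), a strict series `ψ(T) = T + ⋯`, and `n ≥ 2` such that `ψ` is a homomorphism of `n`-BUDS,

  `Δ := ψ(G(X,Y)) - H(ψ(X), ψ(Y)) ≡ 0 (mod deg n)`.

Let `γ_s = [X^s Y^{n-s}]Δ` and `Γ = Σ_s γ_s X^s Y^{n-s}` (so `Δ ≡ Γ (mod deg n+1)`).  Comparing `ψ(G(G(X,Y),Z))` and
`ψ(G(X,G(Y,Z)))` modulo degree `n+1` (Lazard's Lemme 2 computation, with his Lemme 1 = `DegreeCongruence.lean`) gives

* `le_order_budCocycle` — `Γ(X,Y) + Γ(X+Y,Z) ≡ Γ(Y,Z) + Γ(X,Y+Z) (mod deg n+1)`, i.e. `δΓ = 0`;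
* `budCocycle_rel` — the coefficient relations `C(s,i) γ_s = C(n-i,s-i) γ_i` (`1 ≤ i ≤ s ≤ n-1`) and `γ_0 = γ_n = 0`
  (Lazard §III (3.5)–(3.6));
* `budCocycle_symm` — `γ_{n-s} = γ_s` (from the commutativity of `G` and `H`);
* `exists_le_order_bud_sub_lazardPoly` — **with Lazard's comparison lemma** (over `B` with `p` nilpotent,
  `LazardComparisonLemmaNilpotent.lean`): `Δ ≡ c · C_n(X,Y) (mod deg n+1)` for some `c ∈ B` (Lazard's Prop. 2).

## References
* [Lazard1955] M. Lazard, Bull. SMF 83 (1955), §I Lemme 2 and Prop. 1 (p. 256), Lemme 3 and Prop. 2 (p. 257), §III (3.4)–(3.6).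
-/

noncomputable section

namespace Literature.RingTheory.FormalGroups

open MvPowerSeries Finset Finsupp

variable {B : Type*} [CommRing B]

/-! ## §1 Substitution helpers -/

/-- `Φ ≡ 0 (mod deg N)` implies `Φ(a) ≡ 0 (mod deg N)` for arguments without constant term. [cite: Lazard1955, §I Lemme 1] -/
theorem le_order_subst_of_le_order {σ τ : Type*} [Finite σ] [Nonempty σ] {N : ℕ} {Φ : MvPowerSeries σ B}
    (hΦ : (N : ℕ∞) ≤ Φ.order) {a : σ → MvPowerSeries τ B} (ha : ∀ i, constantCoeff (a i) = 0) :
    (N : ℕ∞) ≤ (Φ.subst a).order := by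
  refine le_trans ?_ (MvPowerSeries.le_order_subst (hasSubst_of_constantCoeff_zero ha) Φ)
  refine le_trans hΦ (le_mul_of_one_le_left (by simp) (le_iInf fun i => ?_))
  exact (MvPowerSeries.one_le_order_iff_constCoeff_eq_zero).mpr (ha i)

/-- `(H(ψX₀, ψX₁))(a₀,a₁) = H(ψ(a₀), ψ(a₁))`. [cite: Hazewinkel1978, §1.2 Def. (1.2.1)] -/
theorem subst_formalGroup_psubst (H : FormalGroup B) {ψ : PowerSeries B} (hψ0 : PowerSeries.constantCoeff ψ = 0)
    {τ : Type*} {a : Fin 2 → MvPowerSeries τ B} (ha : ∀ i, constantCoeff (a i) = 0) :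
    subst a (H.toPowerSeries.subst ![PowerSeries.subst (X 0 : MvPowerSeries (Fin 2) B) ψ, PowerSeries.subst (X 1) ψ]) =
      H.toPowerSeries.subst ![PowerSeries.subst (a 0) ψ, PowerSeries.subst (a 1) ψ] := by
  have has : HasSubst a := hasSubst_of_constantCoeff_zero ha
  have hin : HasSubst (![PowerSeries.subst (X 0 : MvPowerSeries (Fin 2) B) ψ, PowerSeries.subst (X 1) ψ] :
      Fin 2 → MvPowerSeries (Fin 2) B) :=
    hasSubst_pair
      (PowerSeries.HasSubst.of_constantCoeff_zero (PowerSeries.constantCoeff_subst_eq_zero (constantCoeff_X 0) ψ hψ0))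
      (PowerSeries.HasSubst.of_constantCoeff_zero (PowerSeries.constantCoeff_subst_eq_zero (constantCoeff_X 1) ψ hψ0))
  rw [subst_comp_subst_apply hin has]
  congr 1
  funext i
  fin_cases i
  · simp only [Fin.zero_eta, Matrix.cons_val_zero]
    rw [subst_powerSeries_subst (PowerSeries.HasSubst.X 0) has, subst_X has]
  · simp only [Fin.mk_one, Matrix.cons_val_one, Matrix.cons_val_fin_one]
    rw [subst_powerSeries_subst (PowerSeries.HasSubst.X 1) has, subst_X has]

/-! ## §2 The bud lemma -/

section Bud

variable (G H : FormalGroup B) {ψ : PowerSeries B} (hψ0 : PowerSeries.constantCoeff ψ = 0) {n : ℕ}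

/-- `Δ ≡ Γ (mod deg n+1)` where `Γ = Σ_s [X^sY^{n-s}]Δ · X^s Y^{n-s}` and `Δ ≡ 0 (mod deg n)`. [cite: Lazard1955, §I (2.1)] -/
theorem le_order_sub_homog {Δ : MvPowerSeries (Fin 2) B} (hΔ : (n : ℕ∞) ≤ Δ.order) :
    ((n + 1 : ℕ) : ℕ∞) ≤ (Δ - ∑ s ∈ range (n + 1),
      coeff (single 0 s + single 1 (n - s)) Δ • ((X 0) ^ s * (X 1) ^ (n - s))).order := by
  rw [natCast_le_order_sub_iff]
  intro d hd
  rw [fin2_eq_single_add_single d] at hd ⊢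
  rw [map_add, degree_single, degree_single] at hd
  by_cases h : d 0 + d 1 = n
  · rw [show d 1 = n - d 0 by omega, coeff_homog _ (by omega)]
  · rw [coeff_homog_of_ne _ h]
    have h' := (natCast_le_order_iff.mp hΔ) (single 0 (d 0) + single 1 (d 1))
      (by rw [map_add, degree_single, degree_single]; omega)
    exact h'

include hψ0 in
/-- **Lazard's bud lemma (Lemme 2): the coboundary of the obstruction vanishes.**  If `Δ = ψ(G(X,Y)) - H(ψX, ψY) ≡ 0 (mod deg n)`
(`n ≥ 1`) and `Γ = Σ γ_s X^s Y^{n-s}` is its degree-`n` part, then `Γ(Y₀,Y₁) + Γ(Y₀+Y₁,Y₂) ≡ Γ(Y₁,Y₂) + Γ(Y₀,Y₁+Y₂) (mod deg n+1)`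
(compare `ψ(G(G(Y₀,Y₁),Y₂)) = ψ(G(Y₀,G(Y₁,Y₂)))` using Lazard's Lemme 1). [cite: Lazard1955, §I Lemme 2] -/
theorem le_order_budCocycle (hn : 1 ≤ n)
    (hΔ : (n : ℕ∞) ≤ (PowerSeries.subst G.toPowerSeries ψ -
      H.toPowerSeries.subst ![PowerSeries.subst (X 0 : MvPowerSeries (Fin 2) B) ψ, PowerSeries.subst (X 1) ψ]).order) :
    let γ : ℕ → B := fun s => coeff (single 0 s + single 1 (n - s)) (PowerSeries.subst G.toPowerSeries ψ -
      H.toPowerSeries.subst ![PowerSeries.subst (X 0 : MvPowerSeries (Fin 2) B) ψ, PowerSeries.subst (X 1) ψ])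
    ((n + 1 : ℕ) : ℕ∞) ≤
      ((∑ s ∈ range (n + 1), γ s • ((X 0 : MvPowerSeries (Fin 3) B) ^ s * (X 1) ^ (n - s)) +
        ∑ s ∈ range (n + 1), γ s • ((X 0 + X 1 : MvPowerSeries (Fin 3) B) ^ s * (X 2) ^ (n - s))) -
       (∑ s ∈ range (n + 1), γ s • ((X 1 : MvPowerSeries (Fin 3) B) ^ s * (X 2) ^ (n - s)) +
        ∑ s ∈ range (n + 1), γ s • ((X 0 : MvPowerSeries (Fin 3) B) ^ s * (X 1 + X 2) ^ (n - s)))).order := by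
  intro γ
  -- names
  set L : MvPowerSeries (Fin 2) B := PowerSeries.subst G.toPowerSeries ψ with hL
  set Rr : MvPowerSeries (Fin 2) B :=
    H.toPowerSeries.subst ![PowerSeries.subst (X 0 : MvPowerSeries (Fin 2) B) ψ, PowerSeries.subst (X 1) ψ] with hRr
  set Δ : MvPowerSeries (Fin 2) B := L - Rr with hΔdef
  set Γ : MvPowerSeries (Fin 2) B := ∑ s ∈ range (n + 1), γ s • ((X 0) ^ s * (X 1) ^ (n - s)) with hΓ
  have hψ := PowerSeries.HasSubst.of_constantCoeff_zero' hψ0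
  have hψY : ∀ i : Fin 3, constantCoeff (PowerSeries.subst (X i : MvPowerSeries (Fin 3) B) ψ) = 0 :=
    fun i => PowerSeries.constantCoeff_subst_eq_zero (constantCoeff_X i) ψ hψ0
  have hψYs : ∀ i : Fin 3, PowerSeries.HasSubst (PowerSeries.subst (X i : MvPowerSeries (Fin 3) B) ψ) :=
    fun i => PowerSeries.HasSubst.of_constantCoeff_zero (hψY i)
  -- the four argument vectors
  set b01 : Fin 2 → MvPowerSeries (Fin 3) B := ![X 0, X 1] with hb01
  set b12 : Fin 2 → MvPowerSeries (Fin 3) B := ![X 1, X 2] with hb12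
  have hb01c : ∀ i, constantCoeff (b01 i) = 0 := by intro i; fin_cases i <;> simp [hb01]
  have hb12c : ∀ i, constantCoeff (b12 i) = 0 := by intro i; fin_cases i <;> simp [hb12]
  set G01 := G.toPowerSeries.subst b01 with hG01
  set G12 := G.toPowerSeries.subst b12 with hG12
  have hG01c : constantCoeff G01 = 0 := constantCoeff_subst_eq_zero (hasSubst_of_constantCoeff_zero hb01c) hb01c G.zero_constantCoeff
  have hG12c : constantCoeff G12 = 0 := constantCoeff_subst_eq_zero (hasSubst_of_constantCoeff_zero hb12c) hb12c G.zero_constantCoeff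
  set a1 : Fin 2 → MvPowerSeries (Fin 3) B := ![G01, X 2] with ha1
  set a2 : Fin 2 → MvPowerSeries (Fin 3) B := ![X 0, G12] with ha2
  have ha1c : ∀ i, constantCoeff (a1 i) = 0 := by
    intro i; fin_cases i
    · exact hG01c
    · simp [ha1]
  have ha2c : ∀ i, constantCoeff (a2 i) = 0 := by
    intro i; fin_cases i
    · simp [ha2]
    · exact hG12c
  -- `ψ(G(a)) = Rr(a) + Δ(a)` and `Rr(a) = H(ψ a₀, ψ a₁)`
  have hLa : ∀ a : Fin 2 → MvPowerSeries (Fin 3) B, (∀ i, constantCoeff (a i) = 0) →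
      PowerSeries.subst (G.toPowerSeries.subst a) ψ =
        H.toPowerSeries.subst ![PowerSeries.subst (a 0) ψ, PowerSeries.subst (a 1) ψ] + subst a Δ := by
    intro a ha
    have has := hasSubst_of_constantCoeff_zero ha
    rw [← subst_powerSeries_subst (hasSubst_formalGroup G) has, ← hL, show L = Rr + Δ by rw [hΔdef]; ring, subst_add has,
      hRr, subst_formalGroup_psubst H hψ0 ha]
  -- associativity of `G` read through `ψ`
  have hT : PowerSeries.subst (G.toPowerSeries.subst a1) ψ = PowerSeries.subst (G.toPowerSeries.subst a2) ψ := by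
    rw [ha1, ha2, hG01, hG12, hb01, hb12, G.assoc]
  rw [hLa a1 ha1c, hLa a2 ha2c] at hT
  simp only [ha1, ha2, Matrix.cons_val_zero, Matrix.cons_val_one] at hT
  -- `ψ(G01) = H(ψY₀,ψY₁) + Δ(Y₀,Y₁)`, `ψ(G12) = H(ψY₁,ψY₂) + Δ(Y₁,Y₂)`
  have h01 := hLa b01 hb01c
  have h12 := hLa b12 hb12c
  simp only [hb01, hb12, Matrix.cons_val_zero, Matrix.cons_val_one] at h01 h12
  rw [← hG01] at h01
  rw [← hG12] at h12
  set U01 := H.toPowerSeries.subst ![PowerSeries.subst (X 0 : MvPowerSeries (Fin 3) B) ψ, PowerSeries.subst (X 1) ψ] with hU01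
  set U12 := H.toPowerSeries.subst ![PowerSeries.subst (X 1 : MvPowerSeries (Fin 3) B) ψ, PowerSeries.subst (X 2) ψ] with hU12
  set D01 := subst b01 Δ with hD01
  set D12 := subst b12 Δ with hD12
  have hU01c : constantCoeff U01 = 0 :=
    constantCoeff_subst_eq_zero (hasSubst_pair (hψYs 0) (hψYs 1)) (fun i => by fin_cases i <;> simp [hψY]) H.zero_constantCoeff
  have hU12c : constantCoeff U12 = 0 :=
    constantCoeff_subst_eq_zero (hasSubst_pair (hψYs 1) (hψYs 2)) (fun i => by fin_cases i <;> simp [hψY]) H.zero_constantCoeff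
  have hD01o : ((n : ℕ) : ℕ∞) ≤ D01.order := le_order_subst_of_le_order hΔ hb01c
  have hD12o : ((n : ℕ) : ℕ∞) ≤ D12.order := le_order_subst_of_le_order hΔ hb12c
  have hD01c : constantCoeff D01 = 0 := by
    have h := (natCast_le_order_iff.mp hD01o) 0 (by simp; omega)
    rwa [coeff_zero_eq_constantCoeff_apply] at h
  have hD12c : constantCoeff D12 = 0 := by
    have h := (natCast_le_order_iff.mp hD12o) 0 (by simp; omega)
    rwa [coeff_zero_eq_constantCoeff_apply] at h
  rw [h01, h12] at hT
  -- (i) first-order expansions in `H`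
  have s1 := formalGroup_le_order_subst_sub_subst_sub H (N := n) hn
    (a := ![U01 + D01, PowerSeries.subst (X 2 : MvPowerSeries (Fin 3) B) ψ])
    (b := ![U01, PowerSeries.subst (X 2 : MvPowerSeries (Fin 3) B) ψ])
    (fun i => by fin_cases i <;> simp [hU01c, hD01c, hψY])
    (fun i => by fin_cases i <;> simp [hU01c, hψY])
    (fun i => by fin_cases i <;> simp [hD01o])
  have s3 := formalGroup_le_order_subst_sub_subst_sub H (N := n) hn
    (a := ![PowerSeries.subst (X 0 : MvPowerSeries (Fin 3) B) ψ, U12 + D12])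
    (b := ![PowerSeries.subst (X 0 : MvPowerSeries (Fin 3) B) ψ, U12])
    (fun i => by fin_cases i <;> simp [hU12c, hD12c, hψY])
    (fun i => by fin_cases i <;> simp [hU12c, hψY])
    (fun i => by fin_cases i <;> simp [hD12o])
  simp only [Matrix.cons_val_zero, Matrix.cons_val_one, sub_self, add_zero, zero_add, add_sub_cancel_left] at s1 s3
  -- (iv) associativity of `H`
  have hHassoc : H.toPowerSeries.subst ![U01, PowerSeries.subst (X 2 : MvPowerSeries (Fin 3) B) ψ] =
      H.toPowerSeries.subst ![PowerSeries.subst (X 0 : MvPowerSeries (Fin 3) B) ψ, U12] := by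
    rw [hU01, hU12]; exact H.assoc' (hψYs 0) (hψYs 1) (hψYs 2)
  -- (ii)/(iii) `Δ(a) ≡ Γ(a)` and `Γ(G01, Y₂) ≡ Γ(Y₀+Y₁, Y₂)`, `Γ(Y₀, G12) ≡ Γ(Y₀, Y₁+Y₂)`
  have hΔΓ : ((n + 1 : ℕ) : ℕ∞) ≤ (Δ - Γ).order := le_order_sub_homog hΔ
  have hΓo : ((n : ℕ) : ℕ∞) ≤ Γ.order := by
    have h := natCast_le_order_sub hΔ (natCast_le_order_of_le hΔΓ (Nat.le_succ n))
    rwa [sub_sub_cancel] at h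
  have hG2 : ((2 : ℕ) : ℕ∞) ≤ (G01 - (X 0 + X 1)).order ∧ ((2 : ℕ) : ℕ∞) ≤ (G12 - (X 1 + X 2)).order := by
    constructor
    · have h := le_order_subst_of_le_order (formalGroup_two_le_order_sub_X_sub_X G) hb01c
      rwa [subst_sub (hasSubst_of_constantCoeff_zero hb01c), subst_sub (hasSubst_of_constantCoeff_zero hb01c),
        subst_X (hasSubst_of_constantCoeff_zero hb01c), subst_X (hasSubst_of_constantCoeff_zero hb01c), ← hG01, hb01,
        Matrix.cons_val_zero, Matrix.cons_val_one, sub_sub] at h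
    · have h := le_order_subst_of_le_order (formalGroup_two_le_order_sub_X_sub_X G) hb12c
      rwa [subst_sub (hasSubst_of_constantCoeff_zero hb12c), subst_sub (hasSubst_of_constantCoeff_zero hb12c),
        subst_X (hasSubst_of_constantCoeff_zero hb12c), subst_X (hasSubst_of_constantCoeff_zero hb12c), ← hG12, hb12,
        Matrix.cons_val_zero, Matrix.cons_val_one, sub_sub] at h
  set c1 : Fin 2 → MvPowerSeries (Fin 3) B := ![X 0 + X 1, X 2] with hc1
  set c2 : Fin 2 → MvPowerSeries (Fin 3) B := ![X 0, X 1 + X 2] with hc2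
  have hc1c : ∀ i, constantCoeff (c1 i) = 0 := by intro i; fin_cases i <;> simp [hc1]
  have hc2c : ∀ i, constantCoeff (c2 i) = 0 := by intro i; fin_cases i <;> simp [hc2]
  have s2a : ((n + 1 : ℕ) : ℕ∞) ≤ (subst a1 Δ - subst a1 Γ).order := by
    rw [← subst_sub (hasSubst_of_constantCoeff_zero ha1c)]; exact le_order_subst_of_le_order hΔΓ ha1c
  have s2b : ((n + 1 : ℕ) : ℕ∞) ≤ (subst a1 Γ - subst c1 Γ).order := by
    have h := le_order_subst_sub_subst (r := n) (N := 2) hn (by norm_num) hΓo ha1c hc1c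
      (fun i => by
        fin_cases i
        · simpa [ha1, hc1] using hG2.1
        · simp [ha1, hc1])
    rwa [show 2 + n - 1 = n + 1 by omega] at h
  have s4a : ((n + 1 : ℕ) : ℕ∞) ≤ (subst a2 Δ - subst a2 Γ).order := by
    rw [← subst_sub (hasSubst_of_constantCoeff_zero ha2c)]; exact le_order_subst_of_le_order hΔΓ ha2c
  have s4b : ((n + 1 : ℕ) : ℕ∞) ≤ (subst a2 Γ - subst c2 Γ).order := by
    have h := le_order_subst_sub_subst (r := n) (N := 2) hn (by norm_num) hΓo ha2c hc2c
      (fun i => by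
        fin_cases i
        · simp [ha2, hc2]
        · simpa [ha2, hc2] using hG2.2)
    rwa [show 2 + n - 1 = n + 1 by omega] at h
  have s5 : ((n + 1 : ℕ) : ℕ∞) ≤ (D01 - subst b01 Γ).order := by
    rw [hD01, ← subst_sub (hasSubst_of_constantCoeff_zero hb01c)]; exact le_order_subst_of_le_order hΔΓ hb01c
  have s6 : ((n + 1 : ℕ) : ℕ∞) ≤ (D12 - subst b12 Γ).order := by
    rw [hD12, ← subst_sub (hasSubst_of_constantCoeff_zero hb12c)]; exact le_order_subst_of_le_order hΔΓ hb12c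
  -- the four substituted `Γ`'s are the four sums of the statement
  have eΓ : ∀ a : Fin 2 → MvPowerSeries (Fin 3) B, (∀ i, constantCoeff (a i) = 0) →
      subst a Γ = ∑ s ∈ range (n + 1), γ s • ((a 0) ^ s * (a 1) ^ (n - s)) :=
    fun a ha => subst_homog γ n (hasSubst_of_constantCoeff_zero ha)
  rw [← show subst b01 Γ = ∑ s ∈ range (n + 1), γ s • ((X 0 : MvPowerSeries (Fin 3) B) ^ s * (X 1) ^ (n - s)) from
      eΓ b01 hb01c,
    ← show subst c1 Γ = ∑ s ∈ range (n + 1), γ s • ((X 0 + X 1 : MvPowerSeries (Fin 3) B) ^ s * (X 2) ^ (n - s)) from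
      eΓ c1 hc1c,
    ← show subst b12 Γ = ∑ s ∈ range (n + 1), γ s • ((X 1 : MvPowerSeries (Fin 3) B) ^ s * (X 2) ^ (n - s)) from
      eΓ b12 hb12c,
    ← show subst c2 Γ = ∑ s ∈ range (n + 1), γ s • ((X 0 : MvPowerSeries (Fin 3) B) ^ s * (X 1 + X 2) ^ (n - s)) from
      eΓ c2 hc2c]
  -- combine
  have key : subst b01 Γ + subst c1 Γ - (subst b12 Γ + subst c2 Γ) =
      (H.toPowerSeries.subst ![PowerSeries.subst (X 0 : MvPowerSeries (Fin 3) B) ψ, U12 + D12] -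
          H.toPowerSeries.subst ![PowerSeries.subst (X 0 : MvPowerSeries (Fin 3) B) ψ, U12] - D12)
        + ((subst a2 Δ - subst a2 Γ) + (subst a2 Γ - subst c2 Γ)) + (D12 - subst b12 Γ)
        - (H.toPowerSeries.subst ![U01 + D01, PowerSeries.subst (X 2 : MvPowerSeries (Fin 3) B) ψ] -
            H.toPowerSeries.subst ![U01, PowerSeries.subst (X 2 : MvPowerSeries (Fin 3) B) ψ] - D01)
        - ((subst a1 Δ - subst a1 Γ) + (subst a1 Γ - subst c1 Γ)) - (D01 - subst b01 Γ) := by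
    linear_combination hT - hHassoc
  rw [key]
  refine natCast_le_order_sub (natCast_le_order_sub (natCast_le_order_add (natCast_le_order_add s3
    (natCast_le_order_add s4a s4b)) s6) s1) ?_ |> fun h => natCast_le_order_sub h s5
  exact natCast_le_order_add s2a s2b

end Bud

end Literature.RingTheory.FormalGroups
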